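import Summits.AtomisticToContinuum.Crystallization.Theorems.ChartedZeroExcessLayeredLatticeLiouvilleTP

/-!
# Zero-excess layered lattice Liouville — part TP, second half (lens-2 g39 node «EnergyNearCharts»): the glue and the columns

Verbatim continuation (§XVII.5–XVII.6) of `…ChartedZeroExcessLayeredLatticeLiouvilleTP` (§XVII.1–XVII.4: `IsEnergyNear`, `UniformTameStabilityE`,
`EnergyNearChartPX`, the re-typed consumers (A⁰ᴱ) (D⁰ᴱ) (C♭ᴱ)), split off ONLY because Theorems files with proofs are capped at 400 lines (gate lint
`statement-form`); no declaration text differs from lens-2 g39's single-file node (sha256 5cffea7c…).  Contents: ★★★ the glue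
`harmonicContractionPGLms_of_ten_pieces_XE` ((HC)(s) ⟸ the ten pieces), `halvingBasinPGLms_of_eleven_pieces_XE`, and the columns
`gap_and_pert_1_50_of_certs_16XH17_tol` (ν generic), `_16XH17` (ν := 1/2000), `_16XH17W`, `_16XH17A0`.  Node, why-easier and sources: see the
module docstring of part TP.  0 sorry; 0 EQUIV; placeholder-free.
-/

noncomputable section

open scoped BigOperators InnerProductSpace RealInnerProductSpace
open MeasureTheory Set Metric Filter Topology
open Summit.AtomisticToContinuum.Crystallization.Theorems.ChartedPlanarOrderRigidityDoor
  (E3 IsClean IsNash IsCharted IsEStarGSC VisibleGap PertRegime atomsIn siteEnergy eStar BindingSurface)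
open Summit.AtomisticToContinuum.Crystallization.Theorems.ChartedPlanarOrderDensityDichotomy (μS IsSep nK nK_nonneg excess)
open Summit.AtomisticToContinuum.Crystallization.Theorems.ChartedPlanarOrderMesoCut (IsDoorSet NearHom LayeredHom EnvClose)
open Summit.AtomisticToContinuum.Crystallization.Theorems.OverbindingBudgetLiouvilleDictionary (NearHomBD)
open Summit.AtomisticToContinuum.Crystallization.Theorems.ChartedPlanarOrderDoorLayered
  (TwoPeriodic DoorPeriodic PeriodicBulkGapDoor gap_and_pert_1_50_of_periodic NearHomL2BD nearHomL2BD_mono nearHomBD_of_nearHomL2BD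
   sq_le_finsum_mem not_nearHomL2BD_singleton envClose_mono Layered layeredHom_eq_layered atomsIn_subset)
open Summit.AtomisticToContinuum.Crystallization.Theorems.ChartedPlanarOrderDoorLayeredOsc (IsTwoShellAffineGood DoorPeriodicOsc)
open Summit.AtomisticToContinuum.Crystallization.Theorems.ChartedPlanarOrderCleanScaleP
  (IsCleanP IsDoorSetP DoorPeriodicP isDoorSetP_mono doorPeriodic_of_doorPeriodicP isDoorSetP_one_iff doorPeriodicP_one_iff)
open Summit.AtomisticToContinuum.Crystallization.Theorems.ChartedPlanarOrderProfileSlavingLJ (pairForce)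
open Literature.MathematicalPhysics.StatisticalMechanics (haggLabel barlowOffset layerNormal IsHaggSeq triangularVec₁ triangularVec₂)



namespace Summit.AtomisticToContinuum.Crystallization.Theorems.ChartedZeroExcessLayeredLatticeLiouville

/-! ### XVII.5  ★★★ The glue: (HC)(s) ⟸ the ten pieces (PROVED) -/

/-- ★★★ **(HC)(s) ⟸ (T) ∧ (U♮ᴱ)(s′,ν) ∧ (A0ˣ)(s,s′) ∧ (N♮)(s′,ν) ∧ (FF) ∧ (E) ∧ (A⁰ᴱ) ∧ (D⁰ᴱ) ∧ (C♭ᴱ) ∧ (R_W) (consumers at s′) (PROVED)** — part TO's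
`harmonicContractionPGLms_of_nine_pieces_X` with the stability certificate localised: (N♮)'s ceiling/floor `(η_N, R_N)` are taken at `(C₁, Cg)` right
after (A0ˣ) fixes `Cg` and joined to the `min`/`max`; the (A0ˣ)-registration `Ψ` makes the chart `ν`-energy-near by (N♮) (energy input
`hasQuadExcess_of_isDoorSetPG`, as for (A0ˣ)); (R_W) keeps the chart, so the same `IsEnergyNear ν` is handed to (A⁰ᴱ), (D⁰ᴱ), (C♭ᴱ); THIN/FAT split,
contraction ratio, levels and every other line verbatim. [this file, g39] -/
theorem harmonicContractionPGLms_of_ten_pieces_XE {aHi Λ θ s s' ν : ℝ} (hT : TailDominationCert) (hU : UniformTameStabilityE s' Λ ν)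
    (h0 : GlobalChartRegistrationPX aHi Λ θ s s') (hN : EnergyNearChartPX aHi Λ θ s' ν) (hF : TailForceSlavingP aHi Λ θ s')
    (hE : LipDualLinearisationP aHi Λ θ s') (hA : L2HarmonicApproxPE aHi Λ θ s' ν) (hD : PositionDecayPLE aHi Λ θ s' ν)
    (hC : PositionCaccioppoliPGE aHi Λ θ s' ν) (hW : WildFractionPG aHi Λ θ s') : HarmonicContractionPGLms aHi Λ θ s := by
  intro hL hL' δ hδ a ha c hc
  -- (A0ˣ): the registration constant `Cg` (energy input: BindingSurface's quadratic excess bound on the PG door); (N♮): its ceiling/floor at `(C₁, Cg)`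
  obtain ⟨C₁, hC₁, hQ⟩ := hasQuadExcess_of_isDoorSetPG (δ := δ) hδ
  obtain ⟨Cg, hCg, η0, hη0, R0, hR0, h0'⟩ := h0 δ hδ a ha C₁ hC₁
  have hCg0 : 0 < Cg := zero_lt_one.trans_le hCg
  obtain ⟨ηN, hηN, RN, hRN, hN'⟩ := hN δ hδ a ha C₁ hC₁ Cg hCg
  -- (R_W): the re-registration constant `Cg' ≥ Cg`
  obtain ⟨Cg', hCgCg', hW'⟩ := hW δ hδ a ha Cg hCg
  have hCg' : 1 ≤ Cg' := hCg.trans hCgCg'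
  -- (C♭ᴱ), (A⁰ᴱ), (D⁰ᴱ), (E): their constants at `Cg'`
  obtain ⟨Cb, hCb, hC'⟩ := hC hT hU δ hδ a ha Cg' hCg'
  obtain ⟨CA, hCA, hA'⟩ := hA hT hU δ hδ a ha Cg' hCg'
  obtain ⟨CD, hCD, ϱD, hϱD, hD'⟩ := hD hT hU hL' δ hδ a ha Cg' hCg' CA hCA
  obtain ⟨Cl, hCl, hE'⟩ := hE δ hδ a ha Cg' hCg'
  have hCb0 : 0 < Cb := zero_lt_one.trans_le hCb
  have hCD0 : 0 < CD := zero_lt_one.trans_le hCD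
  have hCl0 : 0 < Cl := zero_lt_one.trans_le hCl
  -- the contraction ratio `t`, the closeness `ε`, the wild fraction `εw`
  set t : ℝ := min (1 / 128) (c / (3 * Cb * CD + c)) with ht_def
  have ht0 : 0 < t := lt_min (by norm_num) (by positivity)
  have ht128 : t ≤ 1 / 128 := min_le_left _ _
  have ht1 : t ≤ 1 := ht128.trans (by norm_num)
  have hCbCDt : Cb * CD * t ≤ c / 3 := by
    have h1 : t ≤ c / (3 * Cb * CD + c) := min_le_right _ _
    rw [le_div_iff₀ (by positivity)] at h1
    nlinarith [mul_pos hCb0 hCD0, mul_nonneg hc.le ht0.le]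
  have hCbCDt2 : Cb * CD * t ^ 2 ≤ c / 3 := by
    have ht2 : t ^ 2 ≤ t := by nlinarith
    exact (mul_le_mul_of_nonneg_left ht2 (by positivity)).trans hCbCDt
  set ε : ℝ := c * t ^ 5 / (3 * Cb) with hε_def
  have hε : 0 < ε := by positivity
  set εw : ℝ := c * t ^ 3 / (3 * Cb) with hεw_def
  have hεw : 0 < εw := by positivity
  -- (A⁰ᴱ) at `ε`: the residual tolerance `εr` and a range floor; (FF) at `εf := εr/(2C_ℓ)`: a range floor; the range `ϱ`
  obtain ⟨εr, hεr, ϱA, hϱA, hA''⟩ := hA' ε hε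
  set εf : ℝ := εr / (2 * Cl) with hεf_def
  have hεf : 0 < εf := by positivity
  obtain ⟨ϱF, hϱF, hF'⟩ := hF δ hδ a ha Cg' hCg' εf hεf
  set ϱ : ℝ := max (max ϱA ϱD) (max ϱF 1) with hϱ_def
  have hϱA' : ϱA ≤ ϱ := (le_max_left _ _).trans (le_max_left _ _)
  have hϱD' : ϱD ≤ ϱ := (le_max_right _ _).trans (le_max_left _ _)
  have hϱF' : ϱF ≤ ϱ := (le_max_left _ _).trans (le_max_right _ _)
  have hϱ1 : 1 ≤ ϱ := (le_max_right _ _).trans (le_max_right _ _)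
  -- ceilings and floors of every piece at these constants
  obtain ⟨CE, hCE, ηE, hηE, RE, hRE, hE''⟩ := hE' ϱ hϱ1
  have hCE0 : 0 < CE := zero_lt_one.trans_le hCE
  obtain ⟨ηA, hηA, RA, hRA, hA'''⟩ := hA'' ϱ hϱA'
  obtain ⟨ηD, hηD, RD, hRD, hD''⟩ := hD' ϱ hϱD' t ht0 ht128
  obtain ⟨ηF, hηF, RF, hRF, hF''⟩ := hF' ϱ hϱF'
  obtain ⟨ηb, hηb, Rb, hRb, hC''⟩ := hC' t ht0 ht128
  obtain ⟨ηW, hηW, RW, hRW, hW''⟩ :=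
    hW' εw hεw (tameRadius ^ 2 / (2 * Cg)) (div_pos (pow_pos tameRadius_pos 2) (by positivity))
  -- the extra ceiling making the linearisation residual `≤ εr`
  set ηs : ℝ := (εr / (2 * CE)) ^ 2 with hηs_def
  have hηs : 0 < ηs := by positivity
  refine ⟨t, ht0, ht1, min ηN (min (min (min η0 ηW) (min ηE ηA)) (min (min ηD ηF) (min ηb ηs))),
    lt_min hηN (lt_min (lt_min (lt_min hη0 hηW) (lt_min hηE hηA)) (lt_min (lt_min hηD hηF) (lt_min hηb hηs))),
    max RN (max (max (max R0 RW) (max RE RA)) (max (max RD RF) Rb)), lt_max_of_lt_left hRN,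
    fun S hSd hg η hη hηle R hR hms => ?_⟩
  have hηN' : η ≤ ηN := hηle.trans (min_le_left _ _)
  have hηle' : η ≤ min (min (min η0 ηW) (min ηE ηA)) (min (min ηD ηF) (min ηb ηs)) := hηle.trans (min_le_right _ _)
  have hη0' : η ≤ η0 := hηle'.trans ((min_le_left _ _).trans ((min_le_left _ _).trans (min_le_left _ _)))
  have hηW' : η ≤ ηW := hηle'.trans ((min_le_left _ _).trans ((min_le_left _ _).trans (min_le_right _ _)))
  have hηE' : η ≤ ηE := hηle'.trans ((min_le_left _ _).trans ((min_le_right _ _).trans (min_le_left _ _)))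
  have hηA' : η ≤ ηA := hηle'.trans ((min_le_left _ _).trans ((min_le_right _ _).trans (min_le_right _ _)))
  have hηD' : η ≤ ηD := hηle'.trans ((min_le_right _ _).trans ((min_le_left _ _).trans (min_le_left _ _)))
  have hηF' : η ≤ ηF := hηle'.trans ((min_le_right _ _).trans ((min_le_left _ _).trans (min_le_right _ _)))
  have hηb' : η ≤ ηb := hηle'.trans ((min_le_right _ _).trans ((min_le_right _ _).trans (min_le_left _ _)))
  have hηs' : η ≤ ηs := hηle'.trans ((min_le_right _ _).trans ((min_le_right _ _).trans (min_le_right _ _)))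
  have hRN' : RN ≤ R := (le_max_left _ _).trans hR
  have hR' : max (max (max R0 RW) (max RE RA)) (max (max RD RF) Rb) ≤ R := (le_max_right _ _).trans hR
  have hR0' : R0 ≤ R := ((le_max_left _ _).trans ((le_max_left _ _).trans (le_max_left _ _))).trans hR'
  have hRW' : RW ≤ R := ((le_max_right _ _).trans ((le_max_left _ _).trans (le_max_left _ _))).trans hR'
  have hRE' : RE ≤ R := ((le_max_left _ _).trans ((le_max_right _ _).trans (le_max_left _ _))).trans hR'
  have hRA' : RA ≤ R := ((le_max_right _ _).trans ((le_max_right _ _).trans (le_max_left _ _))).trans hR'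
  have hRD' : RD ≤ R := ((le_max_left _ _).trans ((le_max_left _ _).trans (le_max_right _ _))).trans hR'
  have hRF' : RF ≤ R := ((le_max_right _ _).trans ((le_max_left _ _).trans (le_max_right _ _))).trans hR'
  have hRb' : Rb ≤ R := ((le_max_right _ _).trans (le_max_right _ _)).trans hR'
  have hRpos : 0 < R := hR0.trans_le hR0'
  have hN : 0 ≤ nK (atomsIn (μS S) 0 R) := nK_nonneg _
  have hfin : (atomsIn (μS S) 0 R).Finite := finite_atomsIn hδ hSd.1.2.1 R
  -- (A0ˣ): one equilibrium `s'`-chart and one global registration at `(Cg, η, R)`, from the `s`-hypothesis and the energy input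
  obtain ⟨L, w, hEq, Ψ, hG⟩ := h0' S hSd.1 hg (hQ aHi S hSd) η hη hη0' R hR0' hms
  -- (N♮): the chart is `ν`-ENERGY-NEAR (the same energy input, the (A0ˣ)-registration); a property of `(L, w)` alone, it survives re-registration
  have hEN : IsEnergyNear ν (LayeredHom (L : E3 →L[ℝ] E3) w) := hN' S hSd.1 hg (hQ aHi S hSd) η hη hηN' R hRN' L w hEq Ψ hG
  -- THIN/FAT: a registration at `(Cg', η, R)` whose `ϑ₀`-wild mass is `≤ εw·η·nK(win R)`
  obtain ⟨Ψs, hGs, hWs⟩ : ∃ Ψs : E3 → E3, IsGlobalReg Cg' η R S (LayeredHom (L : E3 →L[ℝ] E3) w) Ψs ∧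
      wildMass tameRadius (atomsIn (μS S) 0 R) Ψs ≤ εw * η * nK (atomsIn (μS S) 0 R) := by
    rcases lt_or_ge (η * nK (atomsIn (μS S) 0 R)) (tameRadius ^ 2 / (2 * Cg)) with hthin | hfat
    · -- THIN window: no wild bond at the tame radius; keep `Ψ`, upgraded to the constant `Cg'`
      refine ⟨Ψ, isGlobalReg_mono hCgCg' hη.le hRpos hG, ?_⟩
      obtain ⟨τ, hτ⟩ := hG.2.2.2 R le_rfl
      have hlev : Cg * (R / R) * η * nK (atomsIn (μS S) 0 R) < tameRadius ^ 2 := by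
        rw [div_self hRpos.ne', mul_one]
        calc Cg * η * nK (atomsIn (μS S) 0 R) = Cg * (η * nK (atomsIn (μS S) 0 R)) := by ring
          _ < Cg * (tameRadius ^ 2 / (2 * Cg)) := mul_lt_mul_of_pos_left hthin hCg0
          _ = tameRadius ^ 2 / 2 := by field_simp
          _ ≤ tameRadius ^ 2 := by linarith [sq_nonneg tameRadius]
      rw [wildMass_eq_zero_of_registered hτ hfin tameRadius_pos hlev]
      exact mul_nonneg (mul_nonneg hεw.le hη.le) hN
    · -- FAT window: (R_W) re-registers at `Cg'`
      exact hW'' S hSd hg η hη hηW' R hRW' L w hEq Ψ hG hfat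
  -- (FF): the tail force is `εf`-dual-small; (E): the linearisation residual is `(C_E√η + C_ℓ·εf)`-, hence `εr`-dual-small
  have hFD := hF'' S hSd.1 hg η hη hηF' R hRF' L w hEq Ψs hGs
  have hres := hE'' S hSd.1 hg η hη hηE' R hRE' L w hEq Ψs hGs εf hεf hFD
  have hsmall : CE * Real.sqrt η + Cl * εf ≤ εr := by
    have hsq : Real.sqrt η ≤ εr / (2 * CE) := by
      calc Real.sqrt η ≤ Real.sqrt ηs := Real.sqrt_le_sqrt hηs'
        _ = εr / (2 * CE) := by rw [hηs_def]; exact Real.sqrt_sq (by positivity)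
    have h1 : CE * Real.sqrt η ≤ εr / 2 := by
      calc CE * Real.sqrt η ≤ CE * (εr / (2 * CE)) := mul_le_mul_of_nonneg_left hsq hCE0.le
        _ = εr / 2 := by field_simp
    have h2 : Cl * εf = εr / 2 := by rw [hεf_def]; field_simp
    linarith
  have hres' := linResidualSmall_mono hsmall hres
  -- (A⁰ᴱ): the truncated-harmonic approximant `h`, position-close at level `ε`
  obtain ⟨h, hharm, hgrad, hclose⟩ := hA''' S hSd.1 hg η hη hηA' R hRA' L w hEq hEN Ψs hGs hres'
  have hr2 : 2 * t * R ≤ R / 64 := by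
    have h := mul_le_mul_of_nonneg_left ht128 hRpos.le
    linarith
  have hclose2 := hclose (2 * t * R) (by positivity) hr2
  -- (D⁰ᴱ): an affine-layered Taylor field `T` at the sub-window `win 2tR`
  obtain ⟨T, hTaff, hdec⟩ := hD'' S hSd.1 hg η hη hηD' R hRD' L w hEq hEN Ψs hGs h hharm hgrad
  -- (C♭ᴱ): position-level Caccioppoli at `t·R`, levels rewritten in units `(tR)²·t³·nK(win R)`
  have e1 : ε * η * R ^ 2 * nK (atomsIn (μS S) 0 R) = ε * η / t ^ 5 * (t * R) ^ 2 * (t ^ 3 * nK (atomsIn (μS S) 0 R)) := by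
    field_simp
  have e2 : CD * t ^ 7 * R ^ 2 * η * nK (atomsIn (μS S) 0 R) = CD * η * t ^ 2 * (t * R) ^ 2 * (t ^ 3 * nK (atomsIn (μS S) 0 R)) := by
    ring
  have e3 : εw * η * nK (atomsIn (μS S) 0 R) = εw * η / t ^ 3 * (t ^ 3 * nK (atomsIn (μS S) 0 R)) := by
    field_simp
  rw [e1] at hclose2
  rw [e2] at hdec
  rw [e3] at hWs
  have hout := hC'' S hSd hg η hη hηb' R hRb' L w hEq hEN Ψs hGs h T hTaff (ε * η / t ^ 5) (CD * η * t ^ 2) (εw * η / t ^ 3)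
    (by positivity) (by positivity) (by positivity) hclose2 hdec hWs
  -- the three levels add up to `≤ c·η`
  have hlev : Cb * (ε * η / t ^ 5 + CD * η * t ^ 2 + εw * η / t ^ 3) ≤ c * η := by
    have f1 : Cb * (ε * η / t ^ 5) = c * η / 3 := by rw [hε_def]; field_simp
    have f2 : Cb * (εw * η / t ^ 3) = c * η / 3 := by rw [hεw_def]; field_simp
    have f3 : Cb * (CD * η * t ^ 2) ≤ c * η / 3 := by
      calc Cb * (CD * η * t ^ 2) = Cb * CD * t ^ 2 * η := by ring
        _ ≤ c / 3 * η := mul_le_mul_of_nonneg_right hCbCDt2 hη.le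
        _ = c * η / 3 := by ring
    calc Cb * (ε * η / t ^ 5 + CD * η * t ^ 2 + εw * η / t ^ 3)
        = Cb * (ε * η / t ^ 5) + Cb * (CD * η * t ^ 2) + Cb * (εw * η / t ^ 3) := by ring
      _ ≤ c * η / 3 + c * η / 3 + c * η / 3 := by linarith
      _ = c * η := by ring
  exact nearHomL2BD_mono hlev hout

/-- ★★ **H♭^ℓ,ms(s) ⟸ (P)(s) ∧ the ten pieces (PROVED)**. [this file, g39] -/
theorem halvingBasinPGLms_of_eleven_pieces_XE {aHi Λ θ s s' ν : ℝ} (hP : RegistrationP aHi Λ θ s) (hT : TailDominationCert)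
    (hU : UniformTameStabilityE s' Λ ν) (h0 : GlobalChartRegistrationPX aHi Λ θ s s') (hN : EnergyNearChartPX aHi Λ θ s' ν)
    (hF : TailForceSlavingP aHi Λ θ s') (hE : LipDualLinearisationP aHi Λ θ s') (hA : L2HarmonicApproxPE aHi Λ θ s' ν)
    (hD : PositionDecayPLE aHi Λ θ s' ν) (hC : PositionCaccioppoliPGE aHi Λ θ s' ν) (hW : WildFractionPG aHi Λ θ s') :
    HalvingBasinPGLms aHi Λ θ s :=
  halvingBasinPGLms_of_reg_contr hP (harmonicContractionPGLms_of_ten_pieces_XE hT hU h0 hN hF hE hA hD hC hW)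

/-! ### XVII.6  The columns `_16XH17_tol` (ν generic), `_16XH17` (ν := 1/2000), `_16XH17W`, `_16XH17A0` -/

/-- ★★★ **COLUMN `_16XH17_tol` — TWENTY-TWO opaque leaves at a generic energy tolerance `ν`, NO CHART-WIDE STABILITY LEAF**: `LatticeLiouvilleCert →
LayeredLiouvilleCert → R_G → X → Z_E(1/100) → P(1/100) → T → U♮ᴱ(ν) → B1(1/100) → G♯ˣ → Λ♭ˣ → Υc → Υb → A0♯⁺ → N♮(ν) → FF → E → A⁰ᴱ(ν) → D⁰ᴱ(ν) → C♭ᴱ(ν) →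
R_W → PeriodicBulkGapDoor 2 → VisibleGap (1/50) ∧ PertRegime (1/50)`; `(aHi; Λ, θ) = (1; 2, 1/16)`, producers at `s = 1/100`, consumers at `s′ = 1/50`.
By `UniformTameStabilityE.anti` / `EnergyNearChartPX.mono` the column holds for every `ν` of the window `ε_w < ν < ε_stab` (relaxed-word floor <
ν < energy radius of uniform tame stability); `_16XH17` names the point `ν = 1/2000`. [this file, g39] -/
theorem gap_and_pert_1_50_of_certs_16XH17_tol {ν : ℝ} (hL : LatticeLiouvilleCert) (hL' : LayeredLiouvilleCert)
    (hR : OscRigidityL2BDPG 1 2 (1 / 16) (1 / 16)) (hX : ExcessFlatnessControlP 1 2 (1 / 16) (1 / 16))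
    (hE : ExcessChartLocalisationP 1 2 (1 / 16) (1 / 100)) (hP : RegistrationP 1 2 (1 / 16) (1 / 100))
    (hT : TailDominationCert) (hU : UniformTameStabilityE (1 / 50) 2 ν)
    (h1 : WordTransplantP 1 2 (1 / 16) (1 / 100)) (hGT : GradReframingThickP 1 2 (1 / 16) (1 / 100) (1 / 50))
    (hGl : ThinLaunderingPX 1 2 (1 / 16) (1 / 100) (1 / 50))
    (hUc : UntwistCollarP 1 2 (1 / 16) (1 / 50)) (hUb : UntwistBookkeepingP 1 2 (1 / 50))
    (hl : BondIsoLevelsP 1 2 (1 / 16) (1 / 50)) (hN : EnergyNearChartPX 1 2 (1 / 16) (1 / 50) ν)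
    (hF : TailForceSlavingP 1 2 (1 / 16) (1 / 50))
    (hE' : LipDualLinearisationP 1 2 (1 / 16) (1 / 50)) (hA : L2HarmonicApproxPE 1 2 (1 / 16) (1 / 50) ν)
    (hD : PositionDecayPLE 1 2 (1 / 16) (1 / 50) ν) (hC : PositionCaccioppoliPGE 1 2 (1 / 16) (1 / 50) ν)
    (hW : WildFractionPG 1 2 (1 / 16) (1 / 50)) (hG : PeriodicBulkGapDoor 2) : VisibleGap (1 / 50) ∧ PertRegime (1 / 50) :=
  gap_and_pert_1_50_of_certs_16XHlms_tol hL hL' hR hX hE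
    (halvingBasinPGLms_of_eleven_pieces_XE hP hT hU
      (globalChartRegistrationPX_of_subline (by norm_num) h1 hGT hGl (lateralUntwistP_of_collar_book hUc hUb) hl) hN hF hE' hA hD hC hW) hG

/-- ★★★ **COLUMN `_16XH17` — the column of the (A0)-line with the stability leaf LOCALISED (ν := 1/2000; 22 leaves, no refuted leaf, no chart-wide
stability leaf)**.  Open leaves on the (A0)-line as in `_16XH16`: (B1)(1/100) [XL], (G♯ˣ) [L], (Λ♭ˣ) [L], (Υc) [M], (Υb) [S], (A0♯⁺) [L]; new: (N♮) [M];
re-typed: (U♮ᴱ) [CERT], (A⁰ᴱ) [M–L], (D⁰ᴱ) [M], (C♭ᴱ) [M–L]; producers (Z_E)(1/100), (P)(1/100) UNDECIDED (tolerance-polymorphic in truth, header (c)).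
[this file, g39] -/
theorem gap_and_pert_1_50_of_certs_16XH17 (hL : LatticeLiouvilleCert) (hL' : LayeredLiouvilleCert)
    (hR : OscRigidityL2BDPG 1 2 (1 / 16) (1 / 16)) (hX : ExcessFlatnessControlP 1 2 (1 / 16) (1 / 16))
    (hE : ExcessChartLocalisationP 1 2 (1 / 16) (1 / 100)) (hP : RegistrationP 1 2 (1 / 16) (1 / 100))
    (hT : TailDominationCert) (hU : UniformTameStabilityE (1 / 50) 2 (1 / 2000))
    (h1 : WordTransplantP 1 2 (1 / 16) (1 / 100)) (hGT : GradReframingThickP 1 2 (1 / 16) (1 / 100) (1 / 50))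
    (hGl : ThinLaunderingPX 1 2 (1 / 16) (1 / 100) (1 / 50))
    (hUc : UntwistCollarP 1 2 (1 / 16) (1 / 50)) (hUb : UntwistBookkeepingP 1 2 (1 / 50))
    (hl : BondIsoLevelsP 1 2 (1 / 16) (1 / 50)) (hN : EnergyNearChartPX 1 2 (1 / 16) (1 / 50) (1 / 2000))
    (hF : TailForceSlavingP 1 2 (1 / 16) (1 / 50))
    (hE' : LipDualLinearisationP 1 2 (1 / 16) (1 / 50)) (hA : L2HarmonicApproxPE 1 2 (1 / 16) (1 / 50) (1 / 2000))
    (hD : PositionDecayPLE 1 2 (1 / 16) (1 / 50) (1 / 2000)) (hC : PositionCaccioppoliPGE 1 2 (1 / 16) (1 / 50) (1 / 2000))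
    (hW : WildFractionPG 1 2 (1 / 16) (1 / 50)) (hG : PeriodicBulkGapDoor 2) : VisibleGap (1 / 50) ∧ PertRegime (1 / 50) :=
  gap_and_pert_1_50_of_certs_16XH17_tol hL hL' hR hX hE hP hT hU h1 hGT hGl hUc hUb hl hN hF hE' hA hD hC hW hG

/-- ★ **COLUMN `_16XH17W`** — the same with (A1) «WildReRegistrationPG» in place of (R_W). [this file, g39] -/
theorem gap_and_pert_1_50_of_certs_16XH17W (hL : LatticeLiouvilleCert) (hL' : LayeredLiouvilleCert)
    (hR : OscRigidityL2BDPG 1 2 (1 / 16) (1 / 16)) (hX : ExcessFlatnessControlP 1 2 (1 / 16) (1 / 16))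
    (hE : ExcessChartLocalisationP 1 2 (1 / 16) (1 / 100)) (hP : RegistrationP 1 2 (1 / 16) (1 / 100))
    (hT : TailDominationCert) (hU : UniformTameStabilityE (1 / 50) 2 (1 / 2000))
    (h1 : WordTransplantP 1 2 (1 / 16) (1 / 100)) (hGT : GradReframingThickP 1 2 (1 / 16) (1 / 100) (1 / 50))
    (hGl : ThinLaunderingPX 1 2 (1 / 16) (1 / 100) (1 / 50))
    (hUc : UntwistCollarP 1 2 (1 / 16) (1 / 50)) (hUb : UntwistBookkeepingP 1 2 (1 / 50))
    (hl : BondIsoLevelsP 1 2 (1 / 16) (1 / 50)) (hN : EnergyNearChartPX 1 2 (1 / 16) (1 / 50) (1 / 2000))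
    (hF : TailForceSlavingP 1 2 (1 / 16) (1 / 50))
    (hE' : LipDualLinearisationP 1 2 (1 / 16) (1 / 50)) (hA : L2HarmonicApproxPE 1 2 (1 / 16) (1 / 50) (1 / 2000))
    (hD : PositionDecayPLE 1 2 (1 / 16) (1 / 50) (1 / 2000)) (hC : PositionCaccioppoliPGE 1 2 (1 / 16) (1 / 50) (1 / 2000))
    (hw : WildReRegistrationPG 1 2 (1 / 16) (1 / 50)) (hG : PeriodicBulkGapDoor 2) : VisibleGap (1 / 50) ∧ PertRegime (1 / 50) :=
  gap_and_pert_1_50_of_certs_16XH17 hL hL' hR hX hE hP hT hU h1 hGT hGl hUc hUb hl hN hF hE' hA hD hC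
    (wildFractionPG_of_wildReRegistrationPG hw) hG

/-- ★ **COLUMN `_16XH17A0`** — the surviving P-door node (A0)(1/50) with the producers at `1/100` and the localised stability leaf (16 leaves). [this file, g39] -/
theorem gap_and_pert_1_50_of_certs_16XH17A0 (hL : LatticeLiouvilleCert) (hL' : LayeredLiouvilleCert)
    (hR : OscRigidityL2BDPG 1 2 (1 / 16) (1 / 16)) (hX : ExcessFlatnessControlP 1 2 (1 / 16) (1 / 16))
    (hE : ExcessChartLocalisationP 1 2 (1 / 16) (1 / 100)) (hP : RegistrationP 1 2 (1 / 16) (1 / 100))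
    (hT : TailDominationCert) (hU : UniformTameStabilityE (1 / 50) 2 (1 / 2000))
    (h0 : GlobalChartRegistrationP 1 2 (1 / 16) (1 / 50)) (hN : EnergyNearChartPX 1 2 (1 / 16) (1 / 50) (1 / 2000))
    (hF : TailForceSlavingP 1 2 (1 / 16) (1 / 50))
    (hE' : LipDualLinearisationP 1 2 (1 / 16) (1 / 50)) (hA : L2HarmonicApproxPE 1 2 (1 / 16) (1 / 50) (1 / 2000))
    (hD : PositionDecayPLE 1 2 (1 / 16) (1 / 50) (1 / 2000)) (hC : PositionCaccioppoliPGE 1 2 (1 / 16) (1 / 50) (1 / 2000))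
    (hW : WildFractionPG 1 2 (1 / 16) (1 / 50)) (hG : PeriodicBulkGapDoor 2) : VisibleGap (1 / 50) ∧ PertRegime (1 / 50) :=
  gap_and_pert_1_50_of_certs_16XHlms_tol hL hL' hR hX hE
    (halvingBasinPGLms_of_eleven_pieces_XE hP hT hU (globalChartRegistrationPX_of_globalChartRegistrationP (by norm_num) h0)
      hN hF hE' hA hD hC hW) hG

end Summit.AtomisticToContinuum.Crystallization.Theorems.ChartedZeroExcessLayeredLatticeLiouville

end
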